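import Summits.CriticalPhenomena.Ising3DConformalLimit.Theorems.ExistsScaleCovariantLimit.Negative.DyadicIdentity
import HarnessLib

/-!
# Tightness + dyadic uniqueness ⟹ dyadic convergence of the pinned zoom
(line `Sketch` of the crux `ExistsScaleCovariantLimit`, item stmt-CriticalPhenomena-1981;
stub `stub_dyadicConvergence_of`, step S4)

Pure topology glue (the sub-subsequence argument). The pinned zoom of the critical `ℤ³` Ising
correlators is `k ↦ rescaledCorrelator (criticalCorr 3) rhoPin n ((2^k)⁻¹)` along the dyadic meshes.
Assume

* TIGHTNESS: every mesh sequence `u k ∈ (0,1]`, `u → 0⁺`, has a subsequence along which the zoom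
  converges locally uniformly on `NonCoincident 3 n`, for all `n` simultaneously;
* UNIQUENESS within the dyadic family: any two such limits along dyadic subsequences agree off the
  diagonals.

Then the WHOLE dyadic sequence converges locally uniformly (K1). Proof: tightness applied to
`(2^k)⁻¹` gives `φ₀, S₀`; if the full sequence failed to converge to `S₀ n` uniformly on some compact
`K ⊆ NonCoincident 3 n` (`tendstoLocallyUniformlyOn_iff_forall_isCompact`, `NonCoincident` is open),
extract a bad subsequence `ψ` (`Filter.extraction_of_frequently_atTop`), re-apply tightness along
`ψ` to get `φ₁, S₁`, identify `S₁ = S₀` off the diagonals by uniqueness (both are dyadic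
subsequential limits), and contradict badness at the index `φ₁ j` for `j` large.

Adapted from `ExistsScaleCovariantLimitNegative.pinnedLimit_iff_tight_and_unique` (direction `⇐`,
full filter `𝓝[>] 0`); this is the sequential `atTop` version. No named facts. [folklore]
-/

noncomputable section

namespace Summit.CriticalPhenomena.Ising3DConformalLimit.Cruxes.ExistsScaleCovariantLimit.TwoHierarchies

open Literature.Probability.LatticeModels Filter Set
open scoped Topology
open Summit.CriticalPhenomena.Ising3DConformalLimit.MoebiusLimitExistsOnlyInteraction (rhoPin)
open Summit.CriticalPhenomena.Ising3DConformalLimit.ExistsScaleCovariantLimitNegative.Dyadic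
  (dyad_mem tendsto_dyad)

/-- **S4 — glue: tightness of the pinned zoom + dyadic uniqueness ⟹ K1** (dyadic locally-uniform
convergence of `k ↦ rescaledCorrelator (criticalCorr 3) rhoPin n ((2^k)⁻¹)` on `NonCoincident 3 n`, all
`n`). Sub-subsequence argument on the open set `NonCoincident 3 n`
(`tendstoLocallyUniformlyOn_iff_forall_isCompact`): a failure of uniform convergence on a compact
yields a bad subsequence, which by tightness has a convergent sub-subsequence whose limit is, by
dyadic uniqueness, the candidate limit — contradiction. [folklore] -/
theorem stub_dyadicConvergence_of :
    (∀ u : ℕ → ℝ, (∀ k, u k ∈ Set.Ioc (0:ℝ) 1) → Tendsto u atTop (𝓝[>] (0:ℝ)) →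
      ∃ φ : ℕ → ℕ, StrictMono φ ∧ ∃ S : CorrFamily 3, ∀ n,
        TendstoLocallyUniformlyOn (fun k => rescaledCorrelator (criticalCorr 3) rhoPin n (u (φ k)))
          (S n) atTop (NonCoincident 3 n)) →
    (∀ (φ ψ : ℕ → ℕ) (S S' : CorrFamily 3), StrictMono φ → StrictMono ψ →
      (∀ n : ℕ, TendstoLocallyUniformlyOn
        (fun j : ℕ => rescaledCorrelator (criticalCorr 3) rhoPin n (((2:ℝ) ^ (φ j))⁻¹)) (S n) atTop
        (NonCoincident 3 n)) →
      (∀ n : ℕ, TendstoLocallyUniformlyOn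
        (fun j : ℕ => rescaledCorrelator (criticalCorr 3) rhoPin n (((2:ℝ) ^ (ψ j))⁻¹)) (S' n) atTop
        (NonCoincident 3 n)) →
      ∀ n : ℕ, ∀ x ∈ NonCoincident 3 n, S n x = S' n x) →
    ∃ S : CorrFamily 3, ∀ n : ℕ,
      TendstoLocallyUniformlyOn
        (fun k : ℕ => rescaledCorrelator (criticalCorr 3) rhoPin n (((2:ℝ) ^ k)⁻¹)) (S n) atTop
        (NonCoincident 3 n) := by
  intro htight huniq
  -- tightness along the full dyadic sequence: a candidate limit `S₀` along `φ₀`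
  obtain ⟨φ₀, hφ₀, S₀, h₀⟩ := htight (fun k : ℕ => ((2:ℝ) ^ k)⁻¹) dyad_mem tendsto_dyad
  refine ⟨S₀, fun n => ?_⟩
  rw [tendstoLocallyUniformlyOn_iff_forall_isCompact (isOpen_nonCoincident 3 n)]
  intro K hK hKc
  rw [Metric.tendstoUniformlyOn_iff]
  intro ε hε
  by_contra hnot
  -- a bad subsequence `ψ`
  obtain ⟨ψ, hψ, hbad⟩ := Filter.extraction_of_frequently_atTop (Filter.not_eventually.1 hnot)
  -- tightness along `ψ`: a sub-subsequence `ψ ∘ φ₁` with limit `S₁`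
  obtain ⟨φ₁, hφ₁, S₁, h₁⟩ := htight (fun j : ℕ => ((2:ℝ) ^ (ψ j))⁻¹) (fun j => dyad_mem (ψ j))
    (tendsto_dyad.comp hψ.tendsto_atTop)
  -- dyadic uniqueness: `S₁ = S₀` off the diagonals
  have hEq : ∀ m : ℕ, Set.EqOn (S₁ m) (S₀ m) (NonCoincident 3 m) :=
    fun m x hx => huniq (ψ ∘ φ₁) φ₀ S₁ S₀ (hψ.comp hφ₁) hφ₀ h₁ h₀ m x hx
  have hS' : TendstoLocallyUniformlyOn
      (fun j : ℕ => rescaledCorrelator (criticalCorr 3) rhoPin n (((2:ℝ) ^ (ψ (φ₁ j)))⁻¹)) (S₀ n) atTop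
      (NonCoincident 3 n) := (h₁ n).congr_right (hEq n)
  have hU := (tendstoLocallyUniformlyOn_iff_forall_isCompact (isOpen_nonCoincident 3 n)).1 hS' K hK hKc
  obtain ⟨j, hj⟩ := (Metric.tendstoUniformlyOn_iff.1 hU ε hε).exists
  exact hbad (φ₁ j) hj

end Summit.CriticalPhenomena.Ising3DConformalLimit.Cruxes.ExistsScaleCovariantLimit.TwoHierarchies

end
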